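import Literature.NumberTheory.EllipticCurves.Kato2004.Condition1252
import Literature.NumberTheory.EllipticCurves.TateModuleTwistTransportProofs
import Mathlib.NumberTheory.GaussSum
import Mathlib.RingTheory.RootsOfUnity.AlgebraicallyClosed
import HarnessLib

/-!
# Kato's condition (12.5.2) is invariant under the quadratic twist by `p* = (−1)^{(p−1)/2} p`
# (`√p* ∈ ℚ(ζ_p)`, Gauss) — `Proofs` file: theorems only, no definition, no named fact

Topic `NumberTheory/EllipticCurves`, sub-directory `Kato2004`. Cell `bsd-potss`, seat `bsd-potss-k8q-c2x`
g2 (prover; WIDTH-LEVER second lane of item stmt-BirchSwinnertonDyer-19241 `PlusKatoDivisibilityBranch`,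
rung K8-Gss2, route `QuadraticBranchSignedControl`). HONEST FRAMING: elementary algebra; nothing about
BSD is advanced by this file.

WHY. On the quadratic branch the even main conjecture for a good supersingular `V/ℚ` at the character
`η = ω^{(p−1)/2}` is read on the ADDITIVE twist `W = V^{(p*)}` (`T_pW = T_pV ⊗ η`; the tree's
`Kob03-eta-twist-currency`). Kato's integral Euler-system bound (Thm. 12.5 (4) / Thm. 13.4 (3);
the reduction-free fact `Kato2004.thm13_4_lengthAt_fineSelmerDual_le_of_isEulerSystemClass`) is stated
for `W` under (12.5.2) FOR `W`, whereas the K8 items carry the image hypothesis on `V`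
("`ρ_{V,p^∞}` onto", `∀ m, V.HasSurjectiveModNGaloisRep (p^m)` ⟺ `ImageContainsSL2 V p`,
`Kato2004.imageContainsSL2_iff_forall_hasSurjectiveModNGaloisRep`). Since (12.5.2) only concerns
`Gal(ℚ̄/ℚ(ζ_{p^∞}))` and `√p* ∈ ℚ(ζ_p)` (the quadratic Gauss sum `g = Σ_a (a/p) ζ_p^a` has
`g² = (−1)^{(p−1)/2} p`, Gauss; Ireland–Rosen Prop. 6.3.2), every `σ` fixing the `p`-power roots of
unity fixes `√p*`, so `T_pV` and `T_pW` are isomorphic as `Gal(ℚ̄/ℚ(ζ_{p^∞}))`-modules (Silverman X.5.4: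
`E^{(d)} ≅ E` over `K(√d)`) and (12.5.2) transfers. This file proves exactly that:

* `WeierstrassCurve.exists_tateModule_linearEquiv_of_addEquiv` — functoriality of `T_p`: an additive
  isomorphism `E(K̄) ≃+ E′(K̄)` equivariant for a set `S ⊆ Γ_K` induces a `ℤ_p`-linear isomorphism
  `T_pE ≃ T_pE′` intertwining `ρ_{E,p}(σ)` and `ρ_{E′,p}(σ)` for `σ ∈ S` (Silverman III.§7);
* `Kato2004.imageContainsSL2_of_tateModule_linearEquiv` — (12.5.2) transports along such an
  isomorphism when `S ⊇ Gal(ℚ̄/ℚ(ζ_{p^∞}))` (transport the basis; same matrices);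
* `Kato2004.smul_geomSqrt_primeStar_eq` — `σ√p* = √p*` for every `σ ∈ Γ_ℚ` fixing all `p`-power roots of
  unity (`p` odd), by Mathlib's `gaussSum_sq`;
* `Kato2004.imageContainsSL2_iff_of_smul_eq_quadraticTwist_primeStar` — for `C • W.quadraticTwist p* = V`:
  `ImageContainsSL2 V p ↔ ImageContainsSL2 W p`; and the two hypothesis shapes of Kato Thm. 13.4
  (v)/(3) for `W` from tower surjectivity of `V` (`Kato2004.exists_coker_free_of_smul_eq_quadraticTwist…`,
  `Kato2004.exists_finrank_coker_eq_one_of_imageContainsSL2`).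

References: [Kato2004Asterisque] (12.5.2) (p. 222), Thm. 13.4 (v)/(3) (p. 226); [IrelandRosen1990]
Prop. 6.3.2 (`g² = (−1)^{(p−1)/2} p`); [SilvermanAEC2009] III.§7, X.2 Prop. 2.4, X.5 Cor. 5.4;
tree `Kato2004/Condition1252.lean`, `TateModuleTwistTransportProofs.lean`, `TateModule.lean`.
-/

noncomputable section

open scoped Classical

open Field

universe u

namespace WeierstrassCurve

open Literature.NumberTheory.EllipticCurves

variable {K : Type u} [Field K]

/-- **Functoriality of the Tate module along an equivariant isomorphism of point groups** (Silverman,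
*AEC*, III.§7: `T_ℓ` is a functor): an additive isomorphism `f : X(K̄) ≃+ Y(K̄)` with
`f(σP) = σ f(P)` for all `σ` in a set `S ⊆ Γ_K` induces a `ℤ_p`-linear isomorphism
`L : T_pX ≃ T_pY` with `L(ρ_X(σ) a) = ρ_Y(σ)(L a)` for `σ ∈ S` (componentwise: `TateModule.map`).
[cite: SilvermanAEC2009, III.§7] -/
theorem exists_tateModule_linearEquiv_of_addEquiv (X Y : WeierstrassCurve K) (p : ℕ) [Fact p.Prime]
    (S : Set (absoluteGaloisGroup K)) (f : X.geomPoints ≃+ Y.geomPoints)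
    (hf : ∀ σ ∈ S, ∀ P, f (σ • P) = σ • f P) :
    ∃ L : X.tateModule p ≃ₗ[ℤ_[p]] Y.tateModule p,
      ∀ σ ∈ S, ∀ a, L (X.galoisRepTate p σ a) = Y.galoisRepTate p σ (L a) := by
  let L : X.tateModule p ≃ₗ[ℤ_[p]] Y.tateModule p :=
    { TateModule.map p f.toAddMonoidHom with
      invFun := TateModule.map p f.symm.toAddMonoidHom
      left_inv := fun a ↦ TateModule.ext fun n ↦ by
        change TateModule.proj p n (TateModule.map p f.symm.toAddMonoidHom
          (TateModule.map p f.toAddMonoidHom a)) = _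
        rw [TateModule.proj_map, TateModule.proj_map]
        exact f.symm_apply_apply _
      right_inv := fun b ↦ TateModule.ext fun n ↦ by
        change TateModule.proj p n (TateModule.map p f.toAddMonoidHom
          (TateModule.map p f.symm.toAddMonoidHom b)) = _
        rw [TateModule.proj_map, TateModule.proj_map]
        exact f.apply_symm_apply _ }
  refine ⟨L, fun σ hσ a ↦ TateModule.ext fun n ↦ ?_⟩
  change TateModule.proj p n (TateModule.map p f.toAddMonoidHom (X.galoisRepTate p σ a)) =
    TateModule.proj p n (Y.galoisRepTate p σ (TateModule.map p f.toAddMonoidHom a))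
  rw [TateModule.proj_map, galoisRepTate_apply_apply, galoisRepTate_apply_apply,
    TateModule.proj_smul_of_distribMulAction, TateModule.proj_smul_of_distribMulAction,
    TateModule.proj_map]
  exact hf σ hσ _

end WeierstrassCurve

namespace Literature.NumberTheory.EllipticCurves.Kato2004

open WeierstrassCurve Literature.NumberTheory.GaloisRepresentations

variable {p : ℕ} [Fact p.Prime]

/-- **(12.5.2) transports along a `Gal(ℚ̄/ℚ(ζ_{p^∞}))`-equivariant isomorphism of Tate modules**: if
`L : T_pX ≃ T_pY` intertwines `ρ_X(σ)` and `ρ_Y(σ)` for every `σ` fixing all `p`-power roots of unity,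
then `ImageContainsSL2 X p → ImageContainsSL2 Y p` (the basis `b` of (12.5.2) for `X` is carried to
`L(b)`; matrices of `ρ(σ)` agree). [cite: Kato2004Asterisque, (12.5.2) in Thm. 12.5 (4) (p. 222)] -/
theorem imageContainsSL2_of_tateModule_linearEquiv {X Y : WeierstrassCurve ℚ}
    (L : X.tateModule p ≃ₗ[ℤ_[p]] Y.tateModule p)
    (hL : ∀ σ : absoluteGaloisGroup ℚ, (∀ (n : ℕ) (t : AlgebraicClosure ℚ), t ^ p ^ n = 1 → σ • t = t) →
      ∀ a, L (X.galoisRepTate p σ a) = Y.galoisRepTate p σ (L a))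
    (h : ImageContainsSL2 X p) : ImageContainsSL2 Y p := by
  obtain ⟨b, hb⟩ := h
  refine ⟨b.map L, fun M ↦ ?_⟩
  obtain ⟨σ, hσ, hM⟩ := hb M
  refine ⟨σ, hσ, ?_⟩
  rw [← hM]
  ext i j
  rw [LinearMap.toMatrix_apply, LinearMap.toMatrix_apply, Module.Basis.map_apply, ← hL σ hσ,
    Module.Basis.map_repr, LinearEquiv.trans_apply, LinearEquiv.symm_apply_apply]

/-- **`σ(√p*) = √p*` for every `σ ∈ Γ_ℚ` fixing all `p`-power roots of unity** (`p` odd,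
`p* = (−1)^{⌊p/2⌋} p`): the quadratic Gauss sum `g = Σ_{a ∈ 𝔽_p} (a/p) ζ_p^a ∈ ℚ(ζ_p)` satisfies
`g² = (−1/p)·p = p*` (Mathlib `gaussSum_sq`), so `√p* = ±g` is fixed by `σ`. Here `√p*` is the tree's
chosen square root `WeierstrassCurve.geomSqrt` and "`σ` fixes the `p`-power roots of unity" is the
spelling of `ImageContainsSL2`. [cite: IrelandRosen1990, Prop. 6.3.2] -/
theorem smul_geomSqrt_primeStar_eq (hp2 : p ≠ 2) (σ : absoluteGaloisGroup ℚ)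
    (hσ : ∀ (n : ℕ) (t : AlgebraicClosure ℚ), t ^ p ^ n = 1 → σ • t = t) :
    σ • geomSqrt (((-1 : ℚ) ^ (p / 2)) * p) = geomSqrt (((-1 : ℚ) ^ (p / 2)) * p) := by
  have hp : p.Prime := Fact.out
  haveI : NeZero p := ⟨hp.ne_zero⟩
  haveI : NeZero ((p : ℕ) : AlgebraicClosure ℚ) := ⟨by exact_mod_cast hp.ne_zero⟩
  -- a primitive `p`-th root of unity `ζ`, the additive character `a ↦ ζ^a`, the Legendre character
  obtain ⟨ζ, hζ⟩ := HasEnoughRootsOfUnity.exists_primitiveRoot (AlgebraicClosure ℚ) p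
  have hψ := AddChar.zmodChar_primitive_of_primitive_root p hζ
  set ψ : AddChar (ZMod p) (AlgebraicClosure ℚ) :=
    AddChar.zmodChar p ((IsPrimitiveRoot.iff_def ζ p).mp hζ).left with hψdef
  set χ : MulChar (ZMod p) (AlgebraicClosure ℚ) :=
    (quadraticChar (ZMod p)).ringHomComp (Int.castRingHom (AlgebraicClosure ℚ)) with hχdef
  have hF : ringChar (ZMod p) ≠ 2 := by rw [ZMod.ringChar_zmod_n]; exact hp2
  have hχ1 : χ ≠ 1 :=
    (MulChar.ringHomComp_ne_one_iff (Int.castRingHom (AlgebraicClosure ℚ)).injective_int).mpr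
      (quadraticChar_ne_one hF)
  have hχ2 : χ.IsQuadratic := (quadraticChar_isQuadratic (ZMod p)).comp _
  -- the Gauss sum and its square
  set g : AlgebraicClosure ℚ := gaussSum χ ψ with hgdef
  have hodd : p % 2 = 1 := Nat.odd_iff.mp (hp.odd_of_ne_two hp2)
  have hg2 : g ^ 2 = algebraMap ℚ (AlgebraicClosure ℚ) (((-1 : ℚ) ^ (p / 2)) * p) := by
    rw [hgdef, gaussSum_sq hχ1 hχ2 hψ, ZMod.card p, hχdef, MulChar.ringHomComp_apply,
      quadraticChar_neg_one hF, ZMod.card p, ZMod.χ₄_eq_neg_one_pow hodd]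
    simp
  -- `σ` fixes `g`
  have hσζ : absoluteGaloisGroup.toAlgEquiv ℚ σ ζ = ζ := by
    have := hσ 1 ζ (by rw [pow_one]; exact hζ.pow_eq_one)
    rwa [absoluteGaloisGroup.smul_def] at this
  have hσg : absoluteGaloisGroup.toAlgEquiv ℚ σ g = g := by
    rw [hgdef, gaussSum, map_sum]
    refine Finset.sum_congr rfl fun a _ ↦ ?_
    rw [map_mul, hχdef, MulChar.ringHomComp_apply, eq_intCast, map_intCast, hψdef,
      AddChar.zmodChar_apply, map_pow, hσζ]
  -- `√p* = ± g`
  have hsq : geomSqrt (((-1 : ℚ) ^ (p / 2)) * p) ^ 2 = g ^ 2 := (geomSqrt_sq _).trans hg2.symm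
  rcases sq_eq_sq_iff_eq_or_eq_neg.mp hsq with h | h
  · rw [absoluteGaloisGroup.smul_def, h, hσg]
  · rw [absoluteGaloisGroup.smul_def, h, map_neg, hσg]

/-- **(12.5.2) is invariant under the quadratic twist by `p*`.** For `p` odd and Weierstrass curves
`V, W/ℚ` with `C • W.quadraticTwist p* = V` (`p* = (−1)^{⌊p/2⌋} p`; `V` and `W` are each other's
`p*`-twists up to `ℚ`-isomorphism): `ImageContainsSL2 V p ↔ ImageContainsSL2 W p`. Proof: the
untwisting isomorphism `W^{(p*)}(ℚ̄) ≃+ W(ℚ̄)` is equivariant for every `σ` fixing `√p*`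
(`exists_addEquiv_geomPoints_quadraticTwist`, Silverman X.5.4), the change of variables `C` is
`Γ_ℚ`-equivariant (`VariableChange.pointEquivBaseChange_map_algEquiv`), every `σ ∈ Gal(ℚ̄/ℚ(ζ_{p^∞}))`
fixes `√p*` (`smul_geomSqrt_primeStar_eq`), and `T_p` is a functor.
[cite: Kato2004Asterisque, (12.5.2) in Thm. 12.5 (4) (p. 222)] [cite: SilvermanAEC2009, X.5 Cor. 5.4 and III.§7] -/
theorem imageContainsSL2_iff_of_smul_eq_quadraticTwist_primeStar (hp2 : p ≠ 2)
    {V W : WeierstrassCurve ℚ} (C : VariableChange ℚ)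
    (hWV : C • W.quadraticTwist (((-1 : ℚ) ^ (p / 2)) * p) = V) :
    ImageContainsSL2 V p ↔ ImageContainsSL2 W p := by
  have hp : p.Prime := Fact.out
  subst hWV
  set d : ℚ := ((-1 : ℚ) ^ (p / 2)) * p with hd
  have hd0 : d ≠ 0 := mul_ne_zero (pow_ne_zero _ (by norm_num)) (Nat.cast_ne_zero.mpr hp.ne_zero)
  -- the untwisting `W^{(d)}(ℚ̄) ≃+ W(ℚ̄)`, equivariant on the stabiliser of `√d`
  obtain ⟨f, hf⟩ := exists_addEquiv_geomPoints_quadraticTwist W hd0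
  -- the change of variables `W^{(d)}(ℚ̄) ≃+ (C • W^{(d)})(ℚ̄)`, equivariant for all of `Γ_ℚ`
  let e : (W.quadraticTwist d).geomPoints ≃+ (C • W.quadraticTwist d).geomPoints :=
    VariableChange.pointEquivBaseChange (W.quadraticTwist d) C (AlgebraicClosure ℚ)
  have he : ∀ (σ : absoluteGaloisGroup ℚ) (P : (W.quadraticTwist d).geomPoints),
      e (σ • P) = σ • e P := fun σ P ↦
    VariableChange.pointEquivBaseChange_map_algEquiv (W.quadraticTwist d) C
      (absoluteGaloisGroup.toAlgEquiv ℚ σ) P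
  -- the composite `(C • W^{(d)})(ℚ̄) ≃+ W(ℚ̄)`, equivariant on the stabiliser of `√d`
  let F : (C • W.quadraticTwist d).geomPoints ≃+ W.geomPoints := e.symm.trans f
  have hF : ∀ σ ∈ {σ : absoluteGaloisGroup ℚ | ∀ (n : ℕ) (t : AlgebraicClosure ℚ),
        t ^ p ^ n = 1 → σ • t = t}, ∀ P, F (σ • P) = σ • F P := by
    intro σ hσ P
    have hfix : σ • geomSqrt d = geomSqrt d := smul_geomSqrt_primeStar_eq hp2 σ hσ
    change f (e.symm (σ • P)) = σ • f (e.symm P)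
    have h1 : e.symm (σ • P) = σ • e.symm P := by
      apply e.injective
      rw [AddEquiv.apply_symm_apply, he, AddEquiv.apply_symm_apply]
    rw [h1, hf σ hfix]
  have hFs : ∀ σ ∈ {σ : absoluteGaloisGroup ℚ | ∀ (n : ℕ) (t : AlgebraicClosure ℚ),
        t ^ p ^ n = 1 → σ • t = t}, ∀ Q, F.symm (σ • Q) = σ • F.symm Q := by
    intro σ hσ Q
    apply F.injective
    rw [AddEquiv.apply_symm_apply, hF σ hσ, AddEquiv.apply_symm_apply]
  obtain ⟨L, hL⟩ := exists_tateModule_linearEquiv_of_addEquiv _ _ p _ F hF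
  obtain ⟨L', hL'⟩ := exists_tateModule_linearEquiv_of_addEquiv _ _ p _ F.symm hFs
  exact ⟨fun h ↦ imageContainsSL2_of_tateModule_linearEquiv L (fun σ hσ ↦ hL σ hσ) h,
    fun h ↦ imageContainsSL2_of_tateModule_linearEquiv L' (fun σ hσ ↦ hL' σ hσ) h⟩

/-- **Kato Thm. 13.4 (3)'s image hypothesis for the twist `W` from tower surjectivity of `V`**: if
`C • W.quadraticTwist p* = V`, `p` odd and `ρ̄_{V,p^m}` is onto for every `m`, then some
`σ ∈ Gal(ℚ̄/ℚ(ζ_{p^∞}))` has `Coker(ρ_{W,p}(σ) − 1 : T_pW → T_pW)` free of rank one over `ℤ_p` — the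
hypothesis shape of `Kato2004.thm13_4_lengthAt_fineSelmerDual_le_of_isEulerSystemClass` (3).
[cite: Kato2004Asterisque, Thm. 13.4 (3) (p. 226) and (12.5.2) (p. 222)] -/
theorem exists_coker_free_of_smul_eq_quadraticTwist_primeStar_of_forall_hasSurjectiveModNGaloisRep
    (hp2 : p ≠ 2) {V W : WeierstrassCurve ℚ} [V.IsElliptic] [W.IsElliptic] (C : VariableChange ℚ)
    (hWV : C • W.quadraticTwist (((-1 : ℚ) ^ (p / 2)) * p) = V)
    (hsurj : ∀ m : ℕ, V.HasSurjectiveModNGaloisRep (p ^ m : ℕ)) :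
    ∃ σ : absoluteGaloisGroup ℚ,
      (∀ (n : ℕ) (t : AlgebraicClosure ℚ), t ^ p ^ n = 1 → σ • t = t) ∧
        Nonempty (((W.tateModule p) ⧸ LinearMap.range (W.galoisRepTate p σ - 1)) ≃ₗ[ℤ_[p]] ℤ_[p]) :=
  exists_quotient_range_sub_one_equiv_of_imageContainsSL2 W p
    ((imageContainsSL2_iff_of_smul_eq_quadraticTwist_primeStar hp2 C hWV).mp
      (imageContainsSL2_of_forall_hasSurjectiveModNGaloisRep V p hsurj))

/-- **(12.5.2) ⟹ Kato Thm. 13.4 (v)** for `T_pW`: a `σ ∈ Gal(ℚ̄/ℚ(ζ_{p^∞}))` with `Coker(ρ(σ) − 1)` free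
of rank one has `Coker` of `ℤ_p`-rank one. [cite: Kato2004Asterisque, Thm. 13.4 (v) (p. 226)] -/
theorem exists_finrank_coker_eq_one_of_imageContainsSL2 {W : WeierstrassCurve ℚ} [W.IsElliptic]
    (h : ImageContainsSL2 W p) :
    ∃ σ : absoluteGaloisGroup ℚ,
      (∀ (n : ℕ) (t : AlgebraicClosure ℚ), t ^ p ^ n = 1 → σ • t = t) ∧
        Module.finrank ℤ_[p] ((W.tateModule p) ⧸ LinearMap.range (W.galoisRepTate p σ - 1)) = 1 := by
  obtain ⟨σ, hσ, ⟨e⟩⟩ := exists_quotient_range_sub_one_equiv_of_imageContainsSL2 W p h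
  exact ⟨σ, hσ, by rw [e.finrank_eq, Module.finrank_self]⟩

/-- **Kato Thm. 13.4 (v) for the twist `W` from tower surjectivity of `V`** (`C • W.quadraticTwist p* = V`,
`p` odd). [cite: Kato2004Asterisque, Thm. 13.4 (v) (p. 226) and (12.5.2) (p. 222)] -/
theorem exists_finrank_coker_eq_one_of_smul_eq_quadraticTwist_primeStar_of_forall_hasSurjectiveModNGaloisRep
    (hp2 : p ≠ 2) {V W : WeierstrassCurve ℚ} [V.IsElliptic] [W.IsElliptic] (C : VariableChange ℚ)
    (hWV : C • W.quadraticTwist (((-1 : ℚ) ^ (p / 2)) * p) = V)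
    (hsurj : ∀ m : ℕ, V.HasSurjectiveModNGaloisRep (p ^ m : ℕ)) :
    ∃ σ : absoluteGaloisGroup ℚ,
      (∀ (n : ℕ) (t : AlgebraicClosure ℚ), t ^ p ^ n = 1 → σ • t = t) ∧
        Module.finrank ℤ_[p] ((W.tateModule p) ⧸ LinearMap.range (W.galoisRepTate p σ - 1)) = 1 :=
  exists_finrank_coker_eq_one_of_imageContainsSL2
    ((imageContainsSL2_iff_of_smul_eq_quadraticTwist_primeStar hp2 C hWV).mp
      (imageContainsSL2_of_forall_hasSurjectiveModNGaloisRep V p hsurj))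

end Literature.NumberTheory.EllipticCurves.Kato2004

end
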